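import Literature.NumberTheory.Automorphic.AdelicDoubleQuotientDissection
import HarnessLib

/-!
# Rational representatives of double classes and conjugate arithmetic levels — RANK-GENERIC
# ([Milne 2005] Lemma 5.13 p. 57 and §13 p. 118 L21–26; [Genestier–Ngô 2020] §4.6 Lemma 4.6.1)

Topic `NumberTheory/Automorphic`; namespace `Literature.NumberTheory.Automorphic`, grouping sub-namespaces
`ShimuraDissection.CosetSpace` (generic: any `ι : Γ →* A`, `K ≤ A`) and `UnitaryGroup` (the tree's unitary carriers
`rational F E c N J →* finAdelic F E c N J`, ANY rank `N`). THEOREMS ONLY (no definition, no named fact, no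
`sorry`).

The two group-theoretic bookkeeping steps behind every Hecke translate / transition map between the pieces
`Γ_{g_q} \ X` of `Sh_K = G(ℚ) \ [X × G(𝔸_f)/K]` — today proved in the tree only at rank `3`
(`UnitaryCanonicalModel.exists_rational_rep` / `conj_arithmeticLevel_le` in
`ShimuraVarieties/UnitaryShimuraHeckeComplex.lean` §1, hard-wired `finAdelic … 3 H`) — stated ONCE for any
homomorphism `ι : Γ →* A` and subgroup `K ≤ A`, and read off for the unitary carriers at every rank `N`
(consumers: the rank-`2` Shimura-curve record `ShimuraSetGS` / `RecordSystemGS` of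
`ShimuraVarieties/UnitaryShimuraCurveRecord.lean`, by name):

* `CosetSpace.exists_smul_rep_mem` — **every double class meets its chosen representative up to a rational
  element**: for representatives `g_q ∈ A` of `Ξ = Γ \ (A ⧸ K)` (`∀ q, [g_q K] = q`) and any `a ∈ A` there is
  `γ ∈ Γ` with `(ι(γ) a)⁻¹ g_{[aK]} ∈ K`, i.e. `ι(γ) a K = g_{[aK]} K` («`[x, aK] = [γx, g_{[a]}K]`»,
  [Milne 2005] Lemma 5.13 footnote 41: «Then `a = qgk` for some `q ∈ G(ℚ)`, `g ∈ 𝒞`, `k ∈ K`»).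
* `CosetSpace.stabilizer_pt_le_stabilizer_pt_mul` — `x⁻¹ K x ≤ K'` ⇒ `Stab_Γ(bK) ≤ Stab_Γ(b x K')`
  (`Γ_{b,K} ≤ Γ_{bx,K'}`: the level condition `g⁻¹Kg ≤ K'` of a Hecke operator).
* `CosetSpace.map_conj_stabilizer_pt` — `γ Stab_Γ(y) γ⁻¹ = Stab_Γ(γ • y)`, so with `ι(γ) b x K' = b' K'`:
  `CosetSpace.map_conj_stabilizer_pt_le` — **`γ · Γ_{b,K} · γ⁻¹ ≤ Γ_{b',K'}`**, the condition under which
  `z ↦ γ z : Γ_{b,K} \ X → Γ_{b',K'} \ X` is well defined ([Milne 2005] §13 p. 118 L21–26).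
* Unitary carriers, any rank `N` (`UnitaryGroup.exists_rational_smul_rep_mem`,
  `UnitaryGroup.arithmeticLevel_conj_map_le`): the same two statements for
  `ι = rationalToFinAdelic F E c N J`, with the arithmetic levels `arithmeticLevel F E c N J (b K b⁻¹) ≤ GL_N(E)`
  of the tree (`stabilizer_pt` = `ι⁻¹(bKb⁻¹)`, `arithmeticLevel K = ι⁻¹(K)` pushed into `GL_N(E)`), literally the
  rank-`3` statements of `UnitaryShimuraHeckeComplex` §1 with `3 ↦ N`, `H ↦ J`, `L⁺ ↦ F`.
* §4 (`UnitaryGroup.arithmeticLevel_map_conj_map_le`): the same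
  inclusion read through an embedding `τ : E →+* S` of the coefficients (`GL_N(τ)` commutes with conjugation), i.e.
  for the ARCHIMEDEAN images `Γ^τ ≤ GL_N(ℂ)` that uniformise the pieces — the shape in which the rank-`3` consumers
  (`UnitaryShimuraHeckeComplex` :215–:225, `UnitaryShimuraComplexRecordSystem` :251–:261) apply it.

## References
* [Milne2005ShimuraVarieties] J. S. Milne, *Introduction to Shimura varieties* (2005; held rev. 2017
  `paper:url-b0e8e4ca1c12`), Lemma 5.13 p. 57 (footnotes 40–41), §13 p. 118 L21–26.
* [GenestierNgo2020Lectures] A. Genestier, B. C. Ngô, *Lectures on Shimura varieties*, in *Shimura Varieties*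
  (LMS LN 457, 2020), §4.6 Lemma 4.6.1 (held `book:editornd-shimura-varieties`, PDF p. 73).
-/

set_option autoImplicit false

open Function MulAction

namespace Literature.NumberTheory.Automorphic

namespace ShimuraDissection

namespace CosetSpace

variable {Γ : Type*} {A : Type*} [Group Γ] [Group A] (ι : Γ →* A)

/-! ### §1. Representatives up to a rational element -/

/-- **Every double class meets its chosen representative up to a rational element** ([Milne 2005] Lemma 5.13,
footnote 41: «`a = qgk` for some `q ∈ G(ℚ)`, `g ∈ 𝒞`, `k ∈ K`»): for representatives `g_q ∈ A` of
`Ξ = Γ \ (A ⧸ K)` and any `a ∈ A` there is `γ ∈ Γ` with `(ι(γ) a)⁻¹ g_{[aK]} ∈ K`, i.e. `ι(γ) a K = g_{[aK]} K`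
(«`[x, aK] = [γ x, g_{[a]} K]`»). [cite: Milne2005ShimuraVarieties, Lemma 5.13 p. 57] -/
theorem exists_smul_rep_mem (K : Subgroup A) {g : orbitRel.Quotient Γ (CosetSpace ι K) → A}
    (hg : ∀ q, Quotient.mk'' (pt ι K (g q)) = q) (a : A) :
    ∃ γ : Γ, (ι γ * a)⁻¹ * g (Quotient.mk'' (pt ι K a)) ∈ K := by
  have h := hg (Quotient.mk'' (pt ι K a))
  rw [Quotient.eq''] at h
  obtain ⟨γ, hγ⟩ := MulAction.orbitRel_apply.mp h
  refine ⟨γ, ?_⟩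
  change pt ι K (ι γ * a) = _ at hγ
  exact (pt_eq_pt_iff ι K _ _).mp hγ

/-- The same statement read as an equality of cosets: `ι(γ) a K = g_{[aK]} K`, i.e.
`γ • [aK] = [g_{[aK]} K]` in `A ⧸ K`. [cite: Milne2005ShimuraVarieties, Lemma 5.13 p. 57] -/
theorem exists_smul_pt_eq_pt_rep (K : Subgroup A) {g : orbitRel.Quotient Γ (CosetSpace ι K) → A}
    (hg : ∀ q, Quotient.mk'' (pt ι K (g q)) = q) (a : A) :
    ∃ γ : Γ, γ • pt ι K a = pt ι K (g (Quotient.mk'' (pt ι K a))) := by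
  obtain ⟨γ, hγ⟩ := exists_smul_rep_mem ι K hg a
  exact ⟨γ, by rw [smul_pt, pt_eq_pt_iff]; exact hγ⟩

/-- **Hecke step on representatives** («choose `γ ∈ G(ℚ)` and `q'` with `g_q g ∈ ι(γ)⁻¹ g'_{q'} K'`»): for
representatives `g'` of `Γ \ (A ⧸ K')` and any `a g ∈ A`, there are `γ ∈ Γ` and a class `q'` with
`(ι(γ) a g)⁻¹ g'_{q'} ∈ K'` — namely `q' = [a g K']`. [cite: Milne2005ShimuraVarieties, §13 p. 118 L21–26] -/
theorem exists_smul_mul_rep_mem (K' : Subgroup A) {g' : orbitRel.Quotient Γ (CosetSpace ι K') → A}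
    (hg' : ∀ q, Quotient.mk'' (pt ι K' (g' q)) = q) (a x : A) :
    ∃ (γ : Γ) (q' : orbitRel.Quotient Γ (CosetSpace ι K')), (ι γ * a * x)⁻¹ * g' q' ∈ K' :=
  let ⟨γ, hγ⟩ := exists_smul_rep_mem ι K' hg' (a * x)
  ⟨γ, Quotient.mk'' (pt ι K' (a * x)), by rwa [← mul_assoc] at hγ⟩

/-! ### §2. Conjugate stabilisers («`γ Γ_g γ⁻¹ ≤ Γ_{g'}`») -/

/-- **The level condition of a Hecke operator on stabilisers**: if `x⁻¹ K x ≤ K'` then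
`Stab_Γ(bK) ≤ Stab_Γ(b x K')` (`b⁻¹ ι(δ) b ∈ K ⇒ (bx)⁻¹ ι(δ) (bx) = x⁻¹ (b⁻¹ ι(δ) b) x ∈ K'`).
[cite: Milne2005ShimuraVarieties, §13 p. 118 L21–26] -/
theorem stabilizer_pt_le_stabilizer_pt_mul {K K' : Subgroup A} {x : A} (hK : ∀ k ∈ K, x⁻¹ * k * x ∈ K')
    (b : A) : stabilizer Γ (pt ι K b) ≤ stabilizer Γ (pt ι K' (b * x)) := by
  intro δ hδ
  rw [mem_stabilizer_pt_iff] at hδ ⊢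
  have : (b * x)⁻¹ * ι δ * (b * x) = x⁻¹ * (b⁻¹ * ι δ * b) * x := by group
  rw [this]
  exact hK _ hδ

/-- `γ · Stab_Γ(y) · γ⁻¹ = Stab_Γ(γ • y)` for the action through `ι` on `A ⧸ K` (Mathlib
`MulAction.stabilizer_smul_eq_stabilizer_map_conj`, oriented). [folklore] -/
private theorem map_conj_stabilizer_eq {K : Subgroup A} (γ : Γ) (y : CosetSpace ι K) :
    (stabilizer Γ y).map (MulAut.conj γ).toMonoidHom = stabilizer Γ (γ • y) := by
  rw [stabilizer_smul_eq_stabilizer_map_conj]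

/-- **`γ · Γ_{b,K} · γ⁻¹ = Γ_{ι(γ) b, K}`**: conjugating the stabiliser of `bK` by `γ ∈ Γ` gives the stabiliser of
`ι(γ) b K`. [cite: Milne2005ShimuraVarieties, Lemma 5.13 p. 57] -/
theorem map_conj_stabilizer_pt {K : Subgroup A} (γ : Γ) (b : A) :
    (stabilizer Γ (pt ι K b)).map (MulAut.conj γ).toMonoidHom = stabilizer Γ (pt ι K (ι γ * b)) := by
  rw [map_conj_stabilizer_eq, smul_pt]

/-- **`γ · Γ_{b,K} · γ⁻¹ ≤ Γ_{b',K'}`** — the level condition under which `z ↦ γ z` descends to a map of arithmetic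
quotients `Γ_{b,K} \ X → Γ_{b',K'} \ X`: if `x⁻¹ K x ≤ K'` and `(ι(γ) b x)⁻¹ b' ∈ K'` (i.e. `ι(γ) b x K' = b' K'`) then
conjugation by `γ` carries `Stab_Γ(bK)` into `Stab_Γ(b'K')`
(`ι(γ) b K b⁻¹ ι(γ)⁻¹ = b' k'⁻¹ x⁻¹ K x k' b'⁻¹ ⊆ b' K' b'⁻¹`). [cite: Milne2005ShimuraVarieties, §13 p. 118 L21–26] -/
theorem map_conj_stabilizer_pt_le {K K' : Subgroup A} {x b b' : A} (hK : ∀ k ∈ K, x⁻¹ * k * x ∈ K') {γ : Γ}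
    (hγ : (ι γ * b * x)⁻¹ * b' ∈ K') :
    (stabilizer Γ (pt ι K b)).map (MulAut.conj γ).toMonoidHom ≤ stabilizer Γ (pt ι K' b') := by
  have hb' : pt ι K' (ι γ * (b * x)) = pt ι K' b' := by
    rw [pt_eq_pt_iff, ← mul_assoc]
    exact hγ
  rw [← hb', ← map_conj_stabilizer_pt]
  exact Subgroup.map_mono (stabilizer_pt_le_stabilizer_pt_mul ι hK b)

/-- The same inclusion with the stabilisers spelled as preimages of conjugate levels,
`Stab_Γ(bK) = ι⁻¹(b K b⁻¹)` (`stabilizer_pt`): `γ · ι⁻¹(bKb⁻¹) · γ⁻¹ ≤ ι⁻¹(b'K'b'⁻¹)`.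
[cite: Milne2005ShimuraVarieties, §13 p. 118 L21–26] -/
theorem map_conj_comap_conj_le {K K' : Subgroup A} {x b b' : A} (hK : ∀ k ∈ K, x⁻¹ * k * x ∈ K') {γ : Γ}
    (hγ : (ι γ * b * x)⁻¹ * b' ∈ K') :
    ((K.map (MulAut.conj b).toMonoidHom).comap ι).map (MulAut.conj γ).toMonoidHom ≤
      (K'.map (MulAut.conj b').toMonoidHom).comap ι := by
  rw [← stabilizer_pt, ← stabilizer_pt]
  exact map_conj_stabilizer_pt_le ι hK hγ

end CosetSpace

end ShimuraDissection

/-! ### §3. The unitary carriers at any rank `N` -/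

namespace UnitaryGroup

open ShimuraDissection
open _root_.NumberField

variable {F E : Type} [Field F] [Field E] [NumberField E] [Algebra F E] {c : E ≃ₐ[F] E} {N : ℕ}
  {J : Matrix (Fin N) (Fin N) E}

/-- **Rank-generic `exists_rational_rep`** ([Milne 2005] Lemma 5.13 for `U(J)`, any rank `N`): for
representatives `g_q ∈ U(J)(𝔸_{F,f})` of `Ξ_K = U(J)(F) \ U(J)(𝔸_{F,f}) / K` and any `a`, there is
`γ ∈ U(J)(F)` with `(φ(γ) a)⁻¹ g_{[a]} ∈ K`, i.e. `a K = φ(γ)⁻¹ g_{[a]} K` («`[x, aK] = [γx, g_{[a]}K]`»). The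
rank-`3` statement `UnitaryCanonicalModel.exists_rational_rep` is the case `N = 3`.
[cite: Milne2005ShimuraVarieties, Lemma 5.13 p. 57] -/
theorem exists_rational_smul_rep_mem {K : Subgroup (finAdelic F E c N J)}
    {gq : orbitRel.Quotient (rational F E c N J) (CosetSpace (rationalToFinAdelic F E c N J) K) →
      finAdelic F E c N J}
    (hgq : ∀ q, Quotient.mk'' (CosetSpace.pt (rationalToFinAdelic F E c N J) K (gq q)) = q)
    (a : finAdelic F E c N J) :
    ∃ γ : rational F E c N J,
      (rationalToFinAdelic F E c N J γ * a)⁻¹ *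
          gq (Quotient.mk'' (CosetSpace.pt (rationalToFinAdelic F E c N J) K a)) ∈ K :=
  CosetSpace.exists_smul_rep_mem (rationalToFinAdelic F E c N J) K hgq a

/-- The arithmetic level of a conjugate level is the stabiliser pushed into `GL_N(E)`:
`Γ(bKb⁻¹) = (Stab_{U(J)(F)}(bK)).map subtype`. [cite: Milne2005ShimuraVarieties, Lemma 5.13 p. 57] -/
theorem arithmeticLevel_map_conj_eq_map_stabilizer_pt (K : Subgroup (finAdelic F E c N J))
    (b : finAdelic F E c N J) :
    arithmeticLevel F E c N J (K.map (MulAut.conj b).toMonoidHom) =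
      (stabilizer (rational F E c N J) (CosetSpace.pt (rationalToFinAdelic F E c N J) K b)).map
        (rational F E c N J).subtype := by
  rw [CosetSpace.stabilizer_pt]
  rfl

omit [NumberField E] in
/-- Conjugation by a rational element commutes with the inclusion `U(J)(F) ≤ GL_N(E)`:
`(S.map (conj γ)).map subtype = (S.map subtype).map (conj ↑γ)`. [folklore] -/
private theorem map_subtype_map_conj (S : Subgroup (rational F E c N J)) (γ : rational F E c N J) :
    (S.map (MulAut.conj γ).toMonoidHom).map (rational F E c N J).subtype =
      (S.map (rational F E c N J).subtype).map (MulAut.conj (γ : GL (Fin N) E)).toMonoidHom := by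
  rw [Subgroup.map_map, Subgroup.map_map]
  rfl

/-- **Rank-generic `conj_arithmeticLevel_le`** ([Milne 2005] §13 p. 118 L21–26 for `U(J)`, any rank `N`): if
`g⁻¹ K g ≤ K'` and `(φ(γ) b g)⁻¹ b' ∈ K'`, then `γ · Γ_J(bKb⁻¹) · γ⁻¹ ≤ Γ_J(b'K'b'⁻¹)` — the level condition
under which `z ↦ γ z` descends to the arithmetic quotients
(`φ(γ) b K b⁻¹ φ(γ)⁻¹ = b' k'⁻¹ g⁻¹ K g k' b'⁻¹ ⊆ b' K' b'⁻¹`). The rank-`3` statement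
`UnitaryCanonicalModel.conj_arithmeticLevel_le` is the case `N = 3`.
[cite: Milne2005ShimuraVarieties, §13 p. 118 L21–26] -/
theorem arithmeticLevel_conj_map_le {K K' : Subgroup (finAdelic F E c N J)} {g b b' : finAdelic F E c N J}
    (hK : ∀ k ∈ K, g⁻¹ * k * g ∈ K') {γ : rational F E c N J}
    (hγ : (rationalToFinAdelic F E c N J γ * b * g)⁻¹ * b' ∈ K') :
    (arithmeticLevel F E c N J (K.map (MulAut.conj b).toMonoidHom)).map
        (MulAut.conj (γ : GL (Fin N) E)).toMonoidHom ≤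
      arithmeticLevel F E c N J (K'.map (MulAut.conj b').toMonoidHom) := by
  rw [arithmeticLevel_map_conj_eq_map_stabilizer_pt, arithmeticLevel_map_conj_eq_map_stabilizer_pt,
    ← map_subtype_map_conj]
  exact Subgroup.map_mono (CosetSpace.map_conj_stabilizer_pt_le (rationalToFinAdelic F E c N J) hK hγ)

end UnitaryGroup

/-! ### §4. Reading the inclusion through an embedding of the coefficients (`Γ ↦ Γ^τ ≤ GL_N(S)`) -/

/-- **`GL_N`-functoriality commutes with conjugation on subgroups**: for a ring homomorphism `f : R →+* S`,
`(γ Δ γ⁻¹)^f = γ^f Δ^f (γ^f)⁻¹` as subgroups of `GL_N(S)` (plumbing for `arithmeticLevel_map_conj_map_le`). [folklore] -/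
private theorem _root_.Subgroup.map_conj_map_generalLinearGroup_map {R S : Type*} [CommRing R] [CommRing S] (f : R →+* S)
    {n : Type*} [Fintype n] [DecidableEq n] (Δ : Subgroup (GL n R)) (γ : GL n R) :
    (Δ.map (MulAut.conj γ).toMonoidHom).map (Matrix.GeneralLinearGroup.map f) =
      (Δ.map (Matrix.GeneralLinearGroup.map (n := n) f)).map
        (MulAut.conj (Matrix.GeneralLinearGroup.map f γ)).toMonoidHom := by
  rw [Subgroup.map_map, Subgroup.map_map]
  congr 1
  ext δ i j
  simp [MulAut.conj_apply, map_mul, map_inv]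

namespace UnitaryGroup

open ShimuraDissection
open _root_.NumberField

variable {F E : Type} [Field F] [Field E] [NumberField E] [Algebra F E] {c : E ≃ₐ[F] E} {N : ℕ}
  {J : Matrix (Fin N) (Fin N) E}

/-- **The descent condition for `z ↦ γ z` in archimedean coordinates** ([Milne 2005] §13 p. 118 L21–26, any rank
`N`): under `g⁻¹ K g ≤ K'` and `(φ(γ) b g)⁻¹ b' ∈ K'`, for every embedding `τ : E →+* S` of the coefficients,
`γ^τ · Γ_J(bKb⁻¹)^τ · (γ^τ)⁻¹ ≤ Γ_J(b'K'b'⁻¹)^τ` in `GL_N(S)` — the hypothesis of the tree's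
`UnitaryBallHeckeTranslation.exists_hom_map_unif_mulVec_eq` for the uniformising lattices `Γ^τ`.
[cite: Milne2005ShimuraVarieties, §13 p. 118 L21–26] -/
theorem arithmeticLevel_map_conj_map_le {S : Type*} [CommRing S] (τ : E →+* S)
    {K K' : Subgroup (finAdelic F E c N J)} {g b b' : finAdelic F E c N J}
    (hK : ∀ k ∈ K, g⁻¹ * k * g ∈ K') {γ : rational F E c N J}
    (hγ : (rationalToFinAdelic F E c N J γ * b * g)⁻¹ * b' ∈ K') :
    ((arithmeticLevel F E c N J (K.map (MulAut.conj b).toMonoidHom)).map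
          (Matrix.GeneralLinearGroup.map (n := Fin N) τ)).map
        (MulAut.conj (Matrix.GeneralLinearGroup.map τ (γ : GL (Fin N) E))).toMonoidHom ≤
      (arithmeticLevel F E c N J (K'.map (MulAut.conj b').toMonoidHom)).map
        (Matrix.GeneralLinearGroup.map (n := Fin N) τ) := by
  rw [← Subgroup.map_conj_map_generalLinearGroup_map]
  exact Subgroup.map_mono (arithmeticLevel_conj_map_le hK hγ)

end UnitaryGroup

end Literature.NumberTheory.Automorphic
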